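import Mathlib.Topology.Algebra.ContinuousMonoidHom
import Mathlib.Topology.Algebra.Group.Compact
import Mathlib.Topology.LocallyConstant.Basic
import Mathlib.Topology.Homeomorph.Lemmas

/-!
# Transport of locally constant `2`-cochains along topological isomorphisms onto closed subgroups

Topic `GroupTheory` (profinite groups, explicit cochains); namespace
`Literature.GroupTheory.LocallyConstantCocycles` (as `LocallyConstantCocyclesClosedSubgroups.lean`,
abc-iut-w5-d055, whose conventions are kept).  Proof file: theorems only (no definition, no instance,
no named fact); Mathlib only.

CONVENTIONS (Serre, *Galois Cohomology* I §2.2; [NSW] I §2): `Γ` a topological group, `R` an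
additive commutative group of coefficients with TRIVIAL action, `S ≤ Γ` a subgroup.  A cochain "on
`S`" is a TOTAL function `f : Γ → Γ → R` read on `S × S`: it is *locally constant on `S`* if
`fun x : S × S => f x.1 x.2` is locally constant, a *`2`-cocycle on `S`* if
`f a b + f (a b) c = f b c + f a (b c)` for `a b c ∈ S`, and a *coboundary on `S`* if
`f a b = β a + β b - β (a b)` (`a b ∈ S`) for some `β : Γ → R` locally constant on `S`.  On a
topological group `H` itself (the case `S = ⊤`, as in `TateLocalH2Nonvanishing.lean`) cochains are
`d : H → H → R` with `Function.uncurry d` locally constant.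

WHAT IS HERE — the bookkeeping that moves such cochains along an isomorphism of topological groups
`e : H ≃ₜ* S` onto a subgroup `S ≤ Γ` (e.g. `H = Γ_L` the absolute Galois group of a local field and
`S = D_𝔓 ∩ W` a piece of a decomposition group inside the absolute Galois group of a number field,
[NSW] (12.1.9)):

* `exists_continuousMulEquiv_subgroupMap` — for a continuous injective homomorphism `φ : G → Γ` from
  a compact group to a Hausdorff group and a closed subgroup `U ≤ G`, an isomorphism of topological
  groups `U ≃ₜ* φ(U)` over `φ`;
* `exists_cochainOn_of_cochain` — push a locally constant `2`-cocycle `d` on `H` forward to a cochain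
  on `Γ`, locally constant and a `2`-cocycle on `S`, agreeing with `d` through `e`;
* `coboundary_of_coboundaryOn` / `coboundaryOn_of_coboundary` — coboundaries correspond;
* `exists_cocycleOn_not_coboundaryOn` — hence "there is a locally constant `2`-cocycle on `S` which
  is not a coboundary on `S`" follows from the same statement on `H` (the shape of the local-type
  axioms of Neukirch's characterisation of decomposition groups);
* (restriction to smaller subgroups is abc-iut-w5-d055's `NeukirchAbstract.lc₂_mono` / `coc_mono` /
  `LocallyConstantCocycles.coboundary_mono`, not repeated here).

## References

* J.-P. Serre, *Galois Cohomology* (1997), I §2.2. [SerreGaloisCohomology1997]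
* J. Neukirch, A. Schmidt, K. Wingberg, *Cohomology of Number Fields* (2008), I §2, XII §1
  (12.1.9). [NeukirchSchmidtWingberg2008]
-/

open Topology Function

universe u v w

namespace Literature.GroupTheory.LocallyConstantCocycles

/-! ### A closed subgroup of a compact group is topologically isomorphic to its image -/

section SubgroupMap

variable {G : Type u} [Group G] [TopologicalSpace G] [CompactSpace G]
variable {Γ : Type v} [Group Γ] [TopologicalSpace Γ] [T2Space Γ]

/-- **`U ≃ₜ* φ(U)`**: for a continuous injective homomorphism `φ : G → Γ` from a compact group to a
Hausdorff topological group and a closed subgroup `U ≤ G`, the bijection `U → φ(U)`, `u ↦ φ u`, is an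
isomorphism of topological groups (a continuous bijection from a compact space to a Hausdorff space is
a homeomorphism).  (E.g. `φ = res : Γ_{K_v} → Γ_K`, Neukirch *ANT* II (9.6) `G_w(L|K) ≅ G(L_w|K_v)`.)
[cite: SerreGaloisCohomology1997, I §1.1] -/
theorem exists_continuousMulEquiv_subgroupMap (φ : G →* Γ) (hφ : Continuous φ)
    (hinj : Function.Injective φ) (U : Subgroup G) (hU : IsClosed (U : Set G)) :
    ∃ e : U ≃ₜ* U.map φ, ∀ u : U, ((e u : U.map φ) : Γ) = φ u := by
  haveI : CompactSpace U := isCompact_iff_compactSpace.mp hU.isCompact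
  let e₀ : U ≃* U.map φ := U.equivMapOfInjective φ hinj
  have he₀ : ∀ u : U, ((e₀ u : U.map φ) : Γ) = φ u := fun u => rfl
  have hcont : Continuous e₀ := by
    refine continuous_induced_rng.2 ?_
    have : (Subtype.val ∘ e₀) = fun u : U => φ (u : G) := funext he₀
    rw [this]
    exact hφ.comp continuous_subtype_val
  have hsymm : Continuous e₀.symm :=
    Continuous.continuous_symm_of_equiv_compact_to_t2 (f := e₀.toEquiv) hcont
  exact ⟨{ e₀ with continuous_toFun := hcont, continuous_invFun := hsymm }, he₀⟩

end SubgroupMap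

/-! ### Transport of cochains along `e : H ≃ₜ* S`, `S ≤ Γ` -/

section Transport

variable {H : Type u} [Group H] [TopologicalSpace H]
variable {Γ : Type v} [Group Γ] [TopologicalSpace Γ]
variable {R : Type w} [AddCommGroup R]

/-- **Pushforward of a `2`-cocycle along `e : H ≃ₜ* S`.**  A locally constant `2`-cocycle
`d : H × H → R` on the topological group `H` yields a cochain `f : Γ → Γ → R` which is locally
constant on `S × S`, satisfies the `2`-cocycle identity on `S`, and restricts to `d` through `e`:
`f (e a) (e b) = d a b` (take `f = d ∘ (e⁻¹ × e⁻¹)` on `S × S` and `0` elsewhere).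
[cite: SerreGaloisCohomology1997, I §2.2] -/
theorem exists_cochainOn_of_cochain (S : Subgroup Γ) (e : H ≃ₜ* S) (d : H → H → R)
    (hlc : IsLocallyConstant (Function.uncurry d))
    (hcoc : ∀ a b c : H, d a b + d (a * b) c = d b c + d a (b * c)) :
    ∃ f : Γ → Γ → R,
      IsLocallyConstant (fun x : S × S => f x.1 x.2) ∧
      (∀ a ∈ S, ∀ b ∈ S, ∀ c ∈ S, f a b + f (a * b) c = f b c + f a (b * c)) ∧
      ∀ a b : H, f (e a) (e b) = d a b := by
  classical
  let f : Γ → Γ → R := fun x y =>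
    if h : x ∈ S ∧ y ∈ S then d (e.symm ⟨x, h.1⟩) (e.symm ⟨y, h.2⟩) else 0
  have hf : ∀ (x : S) (y : S), f x y = d (e.symm x) (e.symm y) := by
    intro x y
    simp only [f, dif_pos (And.intro x.2 y.2)]
  have hfe : ∀ a b : H, f (e a) (e b) = d a b := by
    intro a b
    rw [hf, e.symm_apply_apply, e.symm_apply_apply]
  refine ⟨f, ?_, ?_, hfe⟩
  · -- locally constant on `S × S`: `f = d ∘ (e⁻¹ × e⁻¹)` there
    have heq : (fun x : S × S => f x.1 x.2) =
        Function.uncurry d ∘ fun x : S × S => (e.symm x.1, e.symm x.2) := by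
      funext x
      exact hf x.1 x.2
    rw [heq]
    exact hlc.comp_continuous
      ((e.symm.continuous.comp continuous_fst).prodMk (e.symm.continuous.comp continuous_snd))
  · -- the cocycle identity on `S`, pulled back from `H`
    intro a ha b hb c hc
    obtain ⟨a', rfl⟩ : ∃ a' : H, (e a' : Γ) = a := ⟨e.symm ⟨a, ha⟩, by simp⟩
    obtain ⟨b', rfl⟩ : ∃ b' : H, (e b' : Γ) = b := ⟨e.symm ⟨b, hb⟩, by simp⟩
    obtain ⟨c', rfl⟩ : ∃ c' : H, (e c' : Γ) = c := ⟨e.symm ⟨c, hc⟩, by simp⟩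
    have hab : ((e a' : S) : Γ) * (e b' : S) = (e (a' * b') : S) := by
      rw [map_mul, Subgroup.coe_mul]
    have hbc : ((e b' : S) : Γ) * (e c' : S) = (e (b' * c') : S) := by
      rw [map_mul, Subgroup.coe_mul]
    rw [hab, hbc, hfe, hfe, hfe, hfe]
    exact hcoc a' b' c'

/-- **Coboundaries on `S` pull back to coboundaries on `H`**: if `f` restricts to `d` through
`e : H ≃ₜ* S` and `f` is the coboundary on `S` of a cochain `β` locally constant on `S`, then `d` is
the coboundary of the locally constant cochain `β ∘ e` on `H`.
[cite: SerreGaloisCohomology1997, I §2.2] -/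
theorem coboundary_of_coboundaryOn (S : Subgroup Γ) (e : H ≃ₜ* S) {d : H → H → R} {f : Γ → Γ → R}
    (hfe : ∀ a b : H, f (e a) (e b) = d a b) {β : Γ → R}
    (hβ : IsLocallyConstant (fun s : S => β s))
    (hcob : ∀ a ∈ S, ∀ b ∈ S, f a b = β a + β b - β (a * b)) :
    ∃ β' : H → R, IsLocallyConstant β' ∧ ∀ a b : H, d a b = β' a + β' b - β' (a * b) := by
  refine ⟨fun h => β (e h), hβ.comp_continuous e.continuous, fun a b => ?_⟩
  have hab : ((e a : S) : Γ) * (e b : S) = (e (a * b) : S) := by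
    rw [map_mul, Subgroup.coe_mul]
  rw [← hfe, hcob _ (e a).2 _ (e b).2, hab]

/-- **Coboundaries on `H` push forward to coboundaries on `S`**: if `f` restricts to `d` through
`e : H ≃ₜ* S` and `d` is the coboundary of a locally constant cochain on `H`, then `f` is the
coboundary on `S` of a cochain locally constant on `S`.
[cite: SerreGaloisCohomology1997, I §2.2] -/
theorem coboundaryOn_of_coboundary (S : Subgroup Γ) (e : H ≃ₜ* S) {d : H → H → R} {f : Γ → Γ → R}
    (hfe : ∀ a b : H, f (e a) (e b) = d a b) {β' : H → R} (hβ' : IsLocallyConstant β')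
    (hcob : ∀ a b : H, d a b = β' a + β' b - β' (a * b)) :
    ∃ β : Γ → R, IsLocallyConstant (fun s : S => β s) ∧
      ∀ a ∈ S, ∀ b ∈ S, f a b = β a + β b - β (a * b) := by
  classical
  let β : Γ → R := fun x => if h : x ∈ S then β' (e.symm ⟨x, h⟩) else 0
  have hβ : ∀ x : S, β x = β' (e.symm x) := fun x => by simp only [β, dif_pos x.2]
  refine ⟨β, ?_, ?_⟩
  · have heq : (fun s : S => β s) = β' ∘ e.symm := funext hβ
    rw [heq]
    exact hβ'.comp_continuous e.symm.continuous
  · intro a ha b hb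
    obtain ⟨a', rfl⟩ : ∃ a' : H, (e a' : Γ) = a := ⟨e.symm ⟨a, ha⟩, by simp⟩
    obtain ⟨b', rfl⟩ : ∃ b' : H, (e b' : Γ) = b := ⟨e.symm ⟨b, hb⟩, by simp⟩
    have hab : ((e a' : S) : Γ) * (e b' : S) = (e (a' * b') : S) := by
      rw [map_mul, Subgroup.coe_mul]
    rw [hab, hfe, hβ, hβ, hβ, e.symm_apply_apply, e.symm_apply_apply, e.symm_apply_apply]
    exact hcob a' b'

/-- **Transport of "a non-cobounding locally constant `2`-cocycle"** along `e : H ≃ₜ* S`: if the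
topological group `H` carries a locally constant `2`-cocycle `d : H × H → R` which is not the
coboundary of any locally constant cochain, then there is a cochain `f : Γ → Γ → R`, locally constant
and a `2`-cocycle on `S`, which is not the coboundary on `S` of any cochain locally constant on `S` —
the shape of the "local type" conditions `H²(·, R) ≠ 0` in Neukirch's characterisation of
decomposition groups ([NSW] (12.1.9)). [cite: NeukirchSchmidtWingberg2008, XII §1 (12.1.9)] -/
theorem exists_cocycleOn_not_coboundaryOn (S : Subgroup Γ) (e : H ≃ₜ* S)
    (h : ∃ d : H → H → R, IsLocallyConstant (Function.uncurry d) ∧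
      (∀ a b c : H, d a b + d (a * b) c = d b c + d a (b * c)) ∧
      ∀ β' : H → R, IsLocallyConstant β' → ¬ ∀ a b : H, d a b = β' a + β' b - β' (a * b)) :
    ∃ f : Γ → Γ → R,
      IsLocallyConstant (fun x : S × S => f x.1 x.2) ∧
      (∀ a ∈ S, ∀ b ∈ S, ∀ c ∈ S, f a b + f (a * b) c = f b c + f a (b * c)) ∧
      ∀ β : Γ → R, IsLocallyConstant (fun s : S => β s) →
        ¬ ∀ a ∈ S, ∀ b ∈ S, f a b = β a + β b - β (a * b) := by
  obtain ⟨d, hlc, hcoc, hncob⟩ := h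
  obtain ⟨f, hflc, hfcoc, hfe⟩ := exists_cochainOn_of_cochain S e d hlc hcoc
  refine ⟨f, hflc, hfcoc, fun β hβ hcob => ?_⟩
  obtain ⟨β', hβ', hd⟩ := coboundary_of_coboundaryOn S e hfe hβ hcob
  exact hncob β' hβ' hd

/-- The same transport, read backwards: if EVERY locally constant `2`-cocycle on `H` is a coboundary
(`H²(H, R) = 0` in the explicit model), then every cochain on `Γ` which is locally constant and a
`2`-cocycle on `S` and which is pulled back from `H` through `e` is a coboundary on `S`.
[cite: SerreGaloisCohomology1997, I §2.2] -/
theorem coboundaryOn_of_forall_coboundary (S : Subgroup Γ) (e : H ≃ₜ* S)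
    (h : ∀ d : H → H → R, IsLocallyConstant (Function.uncurry d) →
      (∀ a b c : H, d a b + d (a * b) c = d b c + d a (b * c)) →
      ∃ β' : H → R, IsLocallyConstant β' ∧ ∀ a b : H, d a b = β' a + β' b - β' (a * b))
    {f : Γ → Γ → R} (hflc : IsLocallyConstant (fun x : S × S => f x.1 x.2))
    (hfcoc : ∀ a ∈ S, ∀ b ∈ S, ∀ c ∈ S, f a b + f (a * b) c = f b c + f a (b * c)) :
    ∃ β : Γ → R, IsLocallyConstant (fun s : S => β s) ∧
      ∀ a ∈ S, ∀ b ∈ S, f a b = β a + β b - β (a * b) := by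
  -- pull `f` back to `H`
  let d : H → H → R := fun a b => f (e a) (e b)
  have hlc : IsLocallyConstant (Function.uncurry d) := by
    have heq : Function.uncurry d = (fun x : S × S => f x.1 x.2) ∘ fun x : H × H => (e x.1, e x.2) := by
      funext x; rfl
    rw [heq]
    exact hflc.comp_continuous
      ((e.continuous.comp continuous_fst).prodMk (e.continuous.comp continuous_snd))
  have hcoc : ∀ a b c : H, d a b + d (a * b) c = d b c + d a (b * c) := by
    intro a b c
    have hab : ((e a : S) : Γ) * (e b : S) = (e (a * b) : S) := by rw [map_mul, Subgroup.coe_mul]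
    have hbc : ((e b : S) : Γ) * (e c : S) = (e (b * c) : S) := by rw [map_mul, Subgroup.coe_mul]
    have := hfcoc _ (e a).2 _ (e b).2 _ (e c).2
    rw [hab, hbc] at this
    exact this
  obtain ⟨β', hβ', hd⟩ := h d hlc hcoc
  exact coboundaryOn_of_coboundary S e (fun _ _ => rfl) hβ' hd

end Transport

end Literature.GroupTheory.LocallyConstantCocycles
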